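/-
Copyright: pub-rosobs cell (Resolution Observatory), carver gen 41.  Companion file; statements OURS, in
the cell's polynomial weighted-centre model `W(f)`.  Instrument — NOT a resolution theorem.
-/
import Literature.AlgebraicGeometry.Resolution.WeightedCentreBlockMerge
import Literature.AlgebraicGeometry.Resolution.WeightedCentreUmbrellaParityFree
import HarnessLib

/-!
# The pure-power / handle family: concatenated block centres and `p`-power absorption

[cite: AbramovichTemkinWlodarczyk2024, Lemma 5.2.6 (p. 1576) (sums), Thm. 5.3.1 (2)–(3) (p. 1578)
(`inv = max (b₁,…,b_k)` over admissible centres; independence of the coordinates), §5.1 (p. 1575)].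

The family `f = Σ_i X_{a_i}^{e_i} + Σ_j X_{b_j}^{m_j} X_{c_j}` (all variables distinct) of the cell's
census (engine 1, FE33, C136 (d): 2407/2407 decided rows, exponents `≤ 14`, `p ∈ {0, 2, 3, 5}`) with its
DATA LAW `max W(f) = sort (CL_p(e) ∪ {m_j + 1, m_j + 1 : j})`, `CL_p` deleting every `e_i` divisible by
another exponent `e_k = p^n` (`p = char k`; one copy of equal `p`-powers survives; `CL_0 = id`).

Typed here (every statement a kernel theorem; the law itself — the reverse inequality — is NOT claimed):
* §1 finite concatenation of coordinate block centres (`isCentreFor_blocks`, `exps_blocks`,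
  `flatten_mem_admissibleInvariants_blocks`), iterating `WeightedCentreBlockMerge`;
* §2 the family and its explicit centre: `familyExps P H = sort (e_i) ⊔ (m_j+1, m_j+1) ∈ W(f)` in every
  characteristic (`familyExps_mem`);
* §3 ABSORPTION: in characteristic `p`, pure powers `X_d^{p^n t}` are absorbed by a pure power
  `X_{a₀}^{p^n}` through the coordinate change `X_{a₀} ↦ X_{a₀} + Σ_d X_d^{t}`
  (`admissibleInvariants_pureHandle_absorb`: `W` is unchanged by deleting them), hence the LOWER BOUND
  of the law: `familyExps` of the CLEANED lists lies in `W(f)` (`familyExps_mem_of_absorb`); with the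
  maximal deletion `CL_p` this is the census value, so the data law's `≥` half is a theorem and its `≤`
  half is the open part;
* §4 where the cleaned polynomial is one of the cell's typed normal forms the law becomes an EQUALITY theorem:
  `max W(umbrella + Σ X_d^{p t}) = (p, m+1, m+1)` (char `p`), `max W(umbrellaCube + Σ X_d^{2t}) =
  (2, 3, m+1, m+1)` (char 2; char 3 with `Σ X_d^{3t}` absorbed by the cube), `max W(umbrellaPow + Σ X_d^{2t})
  = (2, 3, 3, q)` (char 2, `q` odd) — the census laws' exceptional branch "`char = 2 ∧ q` even" as theorems;
* §5 a worked census-style instance.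
-/

noncomputable section

open MvPolynomial

namespace Literature.AlgebraicGeometry.Resolution.WeightedBlowup

variable {k : Type*} [Field k] {N : ℕ}

/-! ## §1 Finite concatenation of coordinate block centres -/

section Blocks

/-- Pointwise evaluation of a list sum of weight functions (plumbing). [folklore] -/
private theorem list_sum_apply (ws : List (Fin N → ℚ)) (x : Fin N) :
    ws.sum x = (ws.map fun w => w x).sum := by
  induction ws with
  | nil => rfl
  | cons w ws ih => rw [List.sum_cons, List.map_cons, List.sum_cons, Pi.add_apply, ih]

/-- A sum of non-negative weights is non-negative (plumbing). [folklore] -/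
private theorem list_sum_nonneg {ws : List (Fin N → ℚ)} (h : ∀ w ∈ ws, ∀ x, 0 ≤ w x) (x : Fin N) :
    0 ≤ ws.sum x := by
  rw [list_sum_apply]
  exact List.sum_nonneg fun c hc => by
    obtain ⟨w, hw, rfl⟩ := List.mem_map.1 hc
    exact h w hw x

/-- A sum of weights all vanishing at `x` vanishes at `x` (plumbing). [folklore] -/
private theorem list_sum_apply_eq_zero {ws : List (Fin N → ℚ)} {x : Fin N} (h : ∀ w ∈ ws, w x = 0) :
    ws.sum x = 0 := by
  rw [list_sum_apply]
  exact List.sum_eq_zero fun c hc => by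
    obtain ⟨w, hw, rfl⟩ := List.mem_map.1 hc
    exact h w hw

/-- `exps 0 = ()` (the empty centre) (plumbing). [folklore] -/
private theorem exps_zero : exps (0 : Fin N → ℚ) = [] := by
  classical
  simp [exps]

/-- **Weights of finitely many disjointly admissible blocks add up**: if each `γ_b ≥ 0` is admissible for
`g_b`, then `Σ γ_b` is admissible for `Σ g_b`. (derived here) [cite: AbramovichTemkinWlodarczyk2024,
Lemma 5.2.6 (p. 1576) and Rem. 2.4.2 (p. 1568)] -/
theorem isAdmissibleFor_blocks (l : List (MvPolynomial (Fin N) k × (Fin N → ℚ)))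
    (hnonneg : ∀ b ∈ l, ∀ x, 0 ≤ b.2 x) (hadm : ∀ b ∈ l, IsAdmissibleFor b.2 b.1) :
    IsAdmissibleFor (l.map Prod.snd).sum (l.map Prod.fst).sum := by
  induction l with
  | nil =>
      intro d hd
      simp at hd
  | cons b l ih =>
      rw [List.map_cons, List.map_cons, List.sum_cons, List.sum_cons]
      have hl : ∀ b' ∈ l, ∀ x, 0 ≤ b'.2 x := fun b' hb' => hnonneg b' (List.mem_cons_of_mem _ hb')
      exact IsAdmissibleFor.add_of_add (hnonneg b List.mem_cons_self)
        (list_sum_nonneg fun w hw => by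
          obtain ⟨b', hb', rfl⟩ := List.mem_map.1 hw
          exact hl b' hb')
        (hadm b List.mem_cons_self) (ih hl fun b' hb' => hadm b' (List.mem_cons_of_mem _ hb'))

/-- **Concatenated coordinate centre of finitely many blocks.** (derived here)
[cite: AbramovichTemkinWlodarczyk2024, Lemma 5.2.6 (p. 1576)] -/
theorem isCentreFor_blocks (l : List (MvPolynomial (Fin N) k × (Fin N → ℚ)))
    (hnonneg : ∀ b ∈ l, ∀ x, 0 ≤ b.2 x) (hadm : ∀ b ∈ l, IsAdmissibleFor b.2 b.1) :
    IsCentreFor (l.map Prod.fst).sum AlgEquiv.refl (l.map Prod.snd).sum :=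
  ⟨fun x => constantCoeff_X k x, list_sum_nonneg fun w hw => by
      obtain ⟨b, hb, rfl⟩ := List.mem_map.1 hw
      exact hnonneg b hb,
    isAdmissibleFor_blocks l hnonneg hadm⟩

/-- **The invariant of a concatenation of disjointly supported blocks is the sorted merge of the block
invariants.** (derived here) [cite: AbramovichTemkinWlodarczyk2024, §5.1 (p. 1575)] -/
theorem exps_blocks (l : List (MvPolynomial (Fin N) k × (Fin N → ℚ)))
    (hdisj : l.Pairwise fun b b' => ∀ x, b.2 x = 0 ∨ b'.2 x = 0) :
    exps (l.map Prod.snd).sum = (l.map fun b => exps b.2).flatten.insertionSort (· ≤ ·) := by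
  induction l with
  | nil => simpa using (exps_zero (N := N))
  | cons b l ih =>
      rw [List.pairwise_cons] at hdisj
      rw [List.map_cons, List.sum_cons, List.map_cons, List.flatten_cons]
      have h0 : ∀ x, b.2 x = 0 ∨ (l.map Prod.snd).sum x = 0 := by
        intro x
        by_cases hx : b.2 x = 0
        · exact Or.inl hx
        · refine Or.inr (list_sum_apply_eq_zero fun w hw => ?_)
          obtain ⟨b', hb', rfl⟩ := List.mem_map.1 hw
          exact (hdisj.1 b' hb' x).resolve_left hx
      rw [exps_add_eq h0, ih hdisj.2]
      apply List.Perm.eq_of_sortedLE List.sortedLE_insertionSort List.sortedLE_insertionSort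
      exact (List.perm_insertionSort _ _).trans
        (((List.Perm.refl _).append (List.perm_insertionSort _ _)).trans (List.perm_insertionSort _ _).symm)

/-- **`sort (b₁ ++ ⋯ ++ b_r) ∈ W(g₁ + ⋯ + g_r)`** for disjointly supported coordinate block centres
`bᵢ = exps γᵢ`, `γᵢ` admissible for `gᵢ`. (derived here) [cite: AbramovichTemkinWlodarczyk2024, Lemma 5.2.6
(p. 1576) and Thm. 5.3.1 (2) (p. 1578)] -/
theorem flatten_mem_admissibleInvariants_blocks (l : List (MvPolynomial (Fin N) k × (Fin N → ℚ)))
    (hnonneg : ∀ b ∈ l, ∀ x, 0 ≤ b.2 x) (hadm : ∀ b ∈ l, IsAdmissibleFor b.2 b.1)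
    (hdisj : l.Pairwise fun b b' => ∀ x, b.2 x = 0 ∨ b'.2 x = 0) :
    (l.map fun b => exps b.2).flatten.insertionSort (· ≤ ·) ∈ admissibleInvariants (l.map Prod.fst).sum := by
  rw [← exps_blocks l hdisj]
  exact exps_mem_admissibleInvariants (isCentreFor_blocks l hnonneg hadm)

end Blocks

/-! ## §2 The family and its explicit coordinate centre -/

/-- The pure-power part `Σ X_{a}^{e}` over a list of (variable, exponent) (plumbing).
[cite: AbramovichTemkinWlodarczyk2024, §5.1 (p. 1575)] -/
def purePart (P : List (Fin N × ℕ)) : MvPolynomial (Fin N) k := (P.map fun q => X q.1 ^ q.2).sum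

/-- The handle part `Σ X_{b}^{m} X_{c}` over a list of (variable, exponent, variable) (plumbing).
[cite: AbramovichTemkinWlodarczyk2024, §5.1 (p. 1575)] -/
def handlePart (H : List (Fin N × ℕ × Fin N)) : MvPolynomial (Fin N) k :=
  (H.map fun h => X h.1 ^ h.2.1 * X h.2.2).sum

/-- **The pure-power / handle family** `f = Σ_i X_{a_i}^{e_i} + Σ_j X_{b_j}^{m_j} X_{c_j}` of the cell's
census (engine 1, FE33 C136 (d)). [cite: AbramovichTemkinWlodarczyk2024, §5.1 (p. 1575)] -/
def pureHandle (P : List (Fin N × ℕ)) (H : List (Fin N × ℕ × Fin N)) : MvPolynomial (Fin N) k :=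
  purePart P + handlePart H

/-- Unfolding `purePart []` (plumbing). [cite: AbramovichTemkinWlodarczyk2024, §5.1 (p. 1575)] -/
@[simp] theorem purePart_nil : (purePart (k := k) ([] : List (Fin N × ℕ))) = 0 := rfl

/-- Unfolding `purePart (q :: P)` (plumbing). [cite: AbramovichTemkinWlodarczyk2024, §5.1 (p. 1575)] -/
@[simp] theorem purePart_cons (q : Fin N × ℕ) (P : List (Fin N × ℕ)) :
    (purePart (k := k) (q :: P)) = X q.1 ^ q.2 + purePart P := rfl

/-- `purePart` is additive under concatenation (plumbing). [cite: AbramovichTemkinWlodarczyk2024, §5.1 (p. 1575)] -/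
theorem purePart_append (P P' : List (Fin N × ℕ)) :
    (purePart (k := k) (P ++ P')) = purePart P + purePart P' := by
  simp [purePart, List.map_append, List.sum_append]

/-- Unfolding `handlePart []` (plumbing). [cite: AbramovichTemkinWlodarczyk2024, §5.1 (p. 1575)] -/
@[simp] theorem handlePart_nil : (handlePart (k := k) ([] : List (Fin N × ℕ × Fin N))) = 0 := rfl

/-- Unfolding `handlePart (h :: H)` (plumbing). [cite: AbramovichTemkinWlodarczyk2024, §5.1 (p. 1575)] -/
@[simp] theorem handlePart_cons (h : Fin N × ℕ × Fin N) (H : List (Fin N × ℕ × Fin N)) :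
    (handlePart (k := k) (h :: H)) = X h.1 ^ h.2.1 * X h.2.2 + handlePart H := rfl

/-- **The predicted value without cleaning**: `sort ((e_i)_i ++ (m_j + 1, m_j + 1)_j)`.
[cite: AbramovichTemkinWlodarczyk2024, Thm. 5.3.1 (2) (p. 1578)] -/
def familyExps (P : List (Fin N × ℕ)) (H : List (Fin N × ℕ × Fin N)) : List ℚ :=
  ((P.map fun q => (q.2 : ℚ)) ++ (H.map fun h => [(h.2.1 : ℚ) + 1, (h.2.1 : ℚ) + 1]).flatten).insertionSort
    (· ≤ ·)

/-- The handle weights `1/(m+1)` on `b` and on `c`, as a sum of two single blocks (plumbing). [folklore] -/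
private theorem handleWeights_apply (b c : Fin N) (m : ℕ) (x : Fin N) :
    (singleWeights b (m + 1) + singleWeights c (m + 1)) x =
      (if x = b then ((m + 1 : ℕ) : ℚ)⁻¹ else 0) + (if x = c then ((m + 1 : ℕ) : ℚ)⁻¹ else 0) := rfl

/-- The centre `(X_b^{m+1}, X_c^{m+1})` is admissible for the handle `X_b^m X_c`.
[cite: AbramovichTemkinWlodarczyk2024, §5.1 (p. 1575)] -/
theorem isAdmissibleFor_handle {b c : Fin N} (hbc : b ≠ c) (m : ℕ) :
    IsAdmissibleFor (singleWeights b (m + 1) + singleWeights c (m + 1))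
      (X b ^ m * X c : MvPolynomial (Fin N) k) := by
  classical
  intro d hd
  change d ∈ (X b ^ m * X c : MvPolynomial (Fin N) k).support at hd
  rw [X_pow_eq_monomial, X, monomial_mul, mul_one] at hd
  have hd' := support_monomial_subset hd
  rw [Finset.mem_singleton] at hd'
  subst hd'
  rw [monomialValuation, Finsupp.sum_add_index' (by simp) (by intros; push_cast; ring),
    Finsupp.sum_single_index (by simp), Finsupp.sum_single_index (by simp), handleWeights_apply,
    handleWeights_apply, if_pos rfl, if_neg hbc, if_neg (Ne.symm hbc), if_pos rfl]
  have hm : ((m + 1 : ℕ) : ℚ) ≠ 0 := by positivity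
  rw [add_zero, zero_add, Nat.cast_one, one_mul]
  apply le_of_eq
  field_simp
  push_cast
  ring

/-- `exps` of the handle centre is `(m+1, m+1)`. [cite: AbramovichTemkinWlodarczyk2024, §5.1 (p. 1575)] -/
theorem exps_handleWeights {b c : Fin N} (hbc : b ≠ c) (m : ℕ) :
    exps (singleWeights b (m + 1) + singleWeights c (m + 1)) = [(m : ℚ) + 1, (m : ℚ) + 1] := by
  have hdisj : ∀ x, singleWeights b (m + 1) x = 0 ∨ singleWeights c (m + 1) x = 0 := by
    intro x
    by_cases hx : x = b
    · subst hx
      right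
      simp [singleWeights, hbc]
    · left
      simp [singleWeights, hx]
  rw [exps_add_eq hdisj, exps_singleWeights b (Nat.succ_pos m), exps_singleWeights c (Nat.succ_pos m)]
  simp [List.insertionSort]

/-- The block list of the family: pure powers with their single centres, handles with their pair
centres (plumbing). [folklore] -/
def familyBlocks (P : List (Fin N × ℕ)) (H : List (Fin N × ℕ × Fin N)) :
    List (MvPolynomial (Fin N) k × (Fin N → ℚ)) :=
  (P.map fun q => (X q.1 ^ q.2, singleWeights q.1 q.2)) ++
    H.map fun h => (X h.1 ^ h.2.1 * X h.2.2, singleWeights h.1 (h.2.1 + 1) + singleWeights h.2.2 (h.2.1 + 1))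

/-- The block polynomials of the family sum to `f` (plumbing). [folklore] -/
private theorem familyBlocks_fst_sum (P : List (Fin N × ℕ)) (H : List (Fin N × ℕ × Fin N)) :
    ((familyBlocks (k := k) P H).map Prod.fst).sum = pureHandle P H := by
  simp [familyBlocks, pureHandle, purePart, handlePart, List.map_append, List.sum_append, List.map_map,
    Function.comp_def]

/-- The block invariants of the family concatenate to `familyExps` (plumbing). [folklore] -/
private theorem familyBlocks_exps (P : List (Fin N × ℕ)) (H : List (Fin N × ℕ × Fin N))
    (hP : ∀ q ∈ P, 0 < q.2) (hH : ∀ h ∈ H, h.1 ≠ h.2.2) :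
    ((familyBlocks (k := k) P H).map fun b => exps b.2).flatten.insertionSort (· ≤ ·) = familyExps P H := by
  unfold familyExps familyBlocks
  congr 1
  rw [List.map_append, List.flatten_append, List.map_map, List.map_map]
  congr 1
  · -- pure powers: `exps (singleWeights a e) = [e]`
    induction P with
    | nil => rfl
    | cons q P ih =>
        have hq := hP q List.mem_cons_self
        rw [List.map_cons, List.flatten_cons, List.map_cons, Function.comp_apply,
          exps_singleWeights q.1 hq, ih fun q' hq' => hP q' (List.mem_cons_of_mem _ hq')]
        rfl
  · congr 1
    apply List.map_congr_left
    intro h hh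
    rw [Function.comp_apply, exps_handleWeights (hH h hh)]

/-- `singleWeights a e` vanishes off `a` (plumbing). [folklore] -/
private theorem singleWeights_of_ne {a x : Fin N} (e : ℕ) (h : x ≠ a) : singleWeights a e x = 0 := by
  simp [singleWeights, h]

/-- **The explicit centre of the family (every characteristic).** For distinct variables and positive
exponents, `familyExps P H = sort ((e_i) ++ (m_j+1, m_j+1)) ∈ W(Σ X_{a_i}^{e_i} + Σ X_{b_j}^{m_j} X_{c_j})`:
the coordinate centre `(X_{a_i}^{e_i}, X_{b_j}^{m_j+1}, X_{c_j}^{m_j+1})`. (derived here)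
[cite: AbramovichTemkinWlodarczyk2024, Lemma 5.2.6 (p. 1576), §5.1 (p. 1575), Thm. 5.3.1 (2) (p. 1578)] -/
theorem familyExps_mem (P : List (Fin N × ℕ)) (H : List (Fin N × ℕ × Fin N)) (hP : ∀ q ∈ P, 0 < q.2)
    (hnodup : (P.map Prod.fst ++ H.map Prod.fst ++ H.map fun h => h.2.2).Nodup) :
    familyExps P H ∈ admissibleInvariants (pureHandle (k := k) P H) := by
  classical
  -- unpack distinctness
  rw [List.nodup_append', List.nodup_append'] at hnodup
  obtain ⟨⟨hPn, hBn, hPB⟩, hCn, hPBC⟩ := hnodup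
  have hH : ∀ h ∈ H, h.1 ≠ h.2.2 := by
    intro h hh heq
    refine hPBC (List.mem_append_right _ (List.mem_map.2 ⟨h, hh, rfl⟩)) ?_
    exact List.mem_map.2 ⟨h, hh, heq.symm⟩
  rw [← familyBlocks_exps (k := k) P H hP hH, ← familyBlocks_fst_sum (k := k) P H]
  refine flatten_mem_admissibleInvariants_blocks _ (fun b hb x => ?_) (fun b hb => ?_) ?_
  · -- non-negativity
    rcases List.mem_append.1 hb with hb | hb
    · obtain ⟨q, hq, rfl⟩ := List.mem_map.1 hb
      exact (isCentreFor_X_pow (k := k) q.1 (hP q hq)).2.1 x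
    · obtain ⟨h, hh, rfl⟩ := List.mem_map.1 hb
      exact add_nonneg ((isCentreFor_X_pow (k := k) h.1 (Nat.succ_pos _)).2.1 x)
        ((isCentreFor_X_pow (k := k) h.2.2 (Nat.succ_pos _)).2.1 x)
  · -- admissibility of each block
    rcases List.mem_append.1 hb with hb | hb
    · obtain ⟨q, hq, rfl⟩ := List.mem_map.1 hb
      exact (isCentreFor_X_pow (k := k) q.1 (hP q hq)).2.2
    · obtain ⟨h, hh, rfl⟩ := List.mem_map.1 hb
      exact isAdmissibleFor_handle (hH h hh) h.2.1
  · -- pairwise disjoint supports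
    unfold familyBlocks
    rw [List.pairwise_append, List.pairwise_map, List.pairwise_map]
    refine ⟨?_, ?_, ?_⟩
    · -- pure / pure
      have hPn' : P.Pairwise fun q q' => q.1 ≠ q'.1 := List.pairwise_map.1 hPn
      refine hPn'.imp fun {q q'} hqq' x => ?_
      by_cases hx : x = q.1
      · exact Or.inr (singleWeights_of_ne _ (hx ▸ hqq'))
      · exact Or.inl (singleWeights_of_ne _ hx)
    · -- handle / handle
      have hBn' : H.Pairwise fun h h' => h.1 ≠ h'.1 := List.pairwise_map.1 hBn
      have hCn' : H.Pairwise fun h h' => h.2.2 ≠ h'.2.2 := List.pairwise_map.1 hCn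
      have hBC : ∀ h ∈ H, ∀ h' ∈ H, h.1 ≠ h'.2.2 := by
        intro h hh h' hh' heq
        exact hPBC (List.mem_append_right _ (List.mem_map.2 ⟨h, hh, rfl⟩))
          (List.mem_map.2 ⟨h', hh', heq.symm⟩)
      refine (hBn'.and hCn').imp_of_mem fun {h h'} hh hh' hne x => ?_
      simp only [Pi.add_apply]
      by_cases h1 : x = h.1
      · refine Or.inr ?_
        rw [singleWeights_of_ne _ (h1 ▸ hne.1), singleWeights_of_ne _ (h1 ▸ hBC h hh h' hh'), add_zero]
      · by_cases h2 : x = h.2.2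
        · refine Or.inr ?_
          rw [singleWeights_of_ne _ (h2 ▸ (hBC h' hh' h hh).symm), singleWeights_of_ne _ (h2 ▸ hne.2),
            add_zero]
        · exact Or.inl (by rw [singleWeights_of_ne _ h1, singleWeights_of_ne _ h2, add_zero])
    · -- pure / handle
      intro b hb b' hb' x
      obtain ⟨q, hq, rfl⟩ := List.mem_map.1 hb
      obtain ⟨h, hh, rfl⟩ := List.mem_map.1 hb'
      have hqB : q.1 ≠ h.1 := fun heq =>
        hPB (List.mem_map.2 ⟨q, hq, rfl⟩) (List.mem_map.2 ⟨h, hh, heq.symm⟩)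
      have hqC : q.1 ≠ h.2.2 := fun heq =>
        hPBC (List.mem_append_left _ (List.mem_map.2 ⟨q, hq, rfl⟩)) (List.mem_map.2 ⟨h, hh, heq.symm⟩)
      by_cases hx : x = q.1
      · refine Or.inr ?_
        simp only [Pi.add_apply]
        rw [singleWeights_of_ne _ (hx ▸ hqB), singleWeights_of_ne _ (hx ▸ hqC), add_zero]
      · exact Or.inl (singleWeights_of_ne _ hx)

/-! ## §3 Absorption of `p`-power multiples and the lower bound of the law -/

section Absorb

variable (p n : ℕ) [hp : Fact p.Prime] [CharP k p]

/-- The shear `X_a ↦ X_a + Q` fixes a pure part not involving `X_a` (plumbing). [folklore] -/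
private theorem addPolyShear_purePart (a : Fin N) (Q : MvPolynomial (Fin N) k) {P : List (Fin N × ℕ)}
    (hP : ∀ q ∈ P, q.1 ≠ a) : addPolyShear a Q (purePart P) = purePart P := by
  induction P with
  | nil => simp
  | cons q P ih =>
      rw [purePart_cons, map_add, map_pow, addPolyShear_X_of_ne a Q (hP q List.mem_cons_self),
        ih fun q' hq' => hP q' (List.mem_cons_of_mem _ hq')]

/-- The shear `X_a ↦ X_a + Q` fixes a handle part not involving `X_a` (plumbing). [folklore] -/
private theorem addPolyShear_handlePart (a : Fin N) (Q : MvPolynomial (Fin N) k)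
    {H : List (Fin N × ℕ × Fin N)} (hH : ∀ h ∈ H, h.1 ≠ a ∧ h.2.2 ≠ a) :
    addPolyShear a Q (handlePart H) = handlePart H := by
  induction H with
  | nil => simp
  | cons h H ih =>
      have hh := hH h List.mem_cons_self
      rw [handlePart_cons, map_add, map_mul, map_pow, addPolyShear_X_of_ne a Q hh.1,
        addPolyShear_X_of_ne a Q hh.2, ih fun h' hh' => hH h' (List.mem_cons_of_mem _ hh')]

/-- `killVar a` fixes a pure part not involving `X_a` (plumbing). [folklore] -/
private theorem killVar_purePart (a : Fin N) {D : List (Fin N × ℕ)} (hD : ∀ d ∈ D, d.1 ≠ a) :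
    killVar a (purePart (k := k) D) = purePart D := by
  induction D with
  | nil => simp
  | cons d D ih =>
      rw [purePart_cons, map_add, map_pow, killVar_X, if_neg (hD d List.mem_cons_self),
        ih fun d' hd' => hD d' (List.mem_cons_of_mem _ hd')]

/-- A pure part with positive exponents has no constant term (plumbing). [folklore] -/
private theorem constantCoeff_purePart {D : List (Fin N × ℕ)} (hD : ∀ d ∈ D, 0 < d.2) :
    constantCoeff (purePart (k := k) D) = 0 := by
  induction D with
  | nil => simp
  | cons d D ih =>
      rw [purePart_cons, map_add, map_pow, constantCoeff_X, zero_pow (hD d List.mem_cons_self).ne',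
        zero_add, ih fun d' hd' => hD d' (List.mem_cons_of_mem _ hd')]

/-- Freshman's dream for a pure part: `(Σ X_d^{t_d})^{p^n} = Σ X_d^{p^n t_d}` (plumbing). [folklore] -/
private theorem purePart_pow_char_pow (D : List (Fin N × ℕ)) :
    (purePart (k := k) D) ^ p ^ n = purePart (D.map fun d => (d.1, p ^ n * d.2)) := by
  haveI : ExpChar (MvPolynomial (Fin N) k) p := ExpChar.prime hp.out
  induction D with
  | nil => simp [zero_pow (pow_pos hp.out.pos n).ne']
  | cons d D ih =>
      rw [purePart_cons, add_pow_expChar_pow, ih, List.map_cons, purePart_cons, ← pow_mul, mul_comm]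

/-- **Absorption.** In characteristic `p`, next to a pure power `X_{a₀}^{p^n}` every pure power
`X_d^{p^n t_d}` (`t_d ≥ 1`, `d ≠ a₀`) can be deleted without changing `W`:
`W(X_{a₀}^{p^n} + Σ_d X_d^{p^n t_d} + R) = W(X_{a₀}^{p^n} + R)` for `R` = pure part + handle part free
of `X_{a₀}` — via the coordinate change `X_{a₀} ↦ X_{a₀} + Σ_d X_d^{t_d}` and
`(X_{a₀} + Q)^{p^n} = X_{a₀}^{p^n} + Q^{p^n}`. (derived here)
[cite: AbramovichTemkinWlodarczyk2024, Thm. 5.3.1 (2)–(3) (p. 1578) (independence of coordinates)] -/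
theorem admissibleInvariants_pureHandle_absorb (a₀ : Fin N) (D P : List (Fin N × ℕ))
    (H : List (Fin N × ℕ × Fin N)) (hDa : ∀ d ∈ D, d.1 ≠ a₀) (hDpos : ∀ d ∈ D, 0 < d.2)
    (hPa : ∀ q ∈ P, q.1 ≠ a₀) (hHa : ∀ h ∈ H, h.1 ≠ a₀ ∧ h.2.2 ≠ a₀) :
    admissibleInvariants (pureHandle (k := k) ((a₀, p ^ n) :: (D.map (fun d => (d.1, p ^ n * d.2)) ++ P)) H) =
      admissibleInvariants (pureHandle (k := k) ((a₀, p ^ n) :: P) H) := by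
  classical
  haveI : ExpChar (MvPolynomial (Fin N) k) p := ExpChar.prime hp.out
  set Q : MvPolynomial (Fin N) k := purePart D with hQ
  have hfix : killVar a₀ Q = Q := killVar_purePart a₀ hDa
  have h0 : ∀ x, constantCoeff (addPolyShear a₀ Q (X x : MvPolynomial (Fin N) k)) = 0 :=
    constantCoeff_addPolyShear_X a₀ (constantCoeff_purePart hDpos)
  have himage : addPolyShear a₀ Q (pureHandle (k := k) ((a₀, p ^ n) :: P) H) =
      pureHandle ((a₀, p ^ n) :: (D.map (fun d => (d.1, p ^ n * d.2)) ++ P)) H := by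
    rw [pureHandle, pureHandle, purePart_cons, purePart_cons, purePart_append, map_add, map_add, map_pow,
      addPolyShear_X_self, hfix, addPolyShear_purePart a₀ Q hPa, addPolyShear_handlePart a₀ Q hHa,
      add_pow_expChar_pow, hQ, purePart_pow_char_pow p n D]
    ring
  rw [← himage, admissibleInvariants_map_eq _ h0]

/-- **Lower bound of the family law (`≥` half of FE33 C136 (d)).** In characteristic `p`, with all
variables distinct: if `(a₀, p^n)` is a pure power of `f` and `D` lists pure powers whose exponents are
multiples `p^n t_d ≥ p^n`, then the value predicted AFTER deleting `D`,
`familyExps ((a₀, p^n) :: P) H = sort (p^n, (e_i)_{P}, (m_j+1, m_j+1)_j)`, is an admissible invariant of the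
full `f = X_{a₀}^{p^n} + Σ_D X^{p^n t_d} + Σ_P X^{e} + Σ_H X^m X'`.  With the maximal deletion (`CL_p`:
every exponent divisible by the least `p`-power exponent present) this is the census value of
`max W(f)` (2407/2407 rows, data); the reverse inequality is not claimed. (derived here)
[cite: AbramovichTemkinWlodarczyk2024, Lemma 5.2.6 (p. 1576), Thm. 5.3.1 (2)–(3) (p. 1578)] -/
theorem familyExps_mem_of_absorb (a₀ : Fin N) (D P : List (Fin N × ℕ)) (H : List (Fin N × ℕ × Fin N))
    (hDpos : ∀ d ∈ D, 0 < d.2) (hP : ∀ q ∈ P, 0 < q.2)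
    (hnodup : ((a₀ :: (D.map Prod.fst ++ P.map Prod.fst)) ++ H.map Prod.fst ++ H.map fun h => h.2.2).Nodup) :
    familyExps ((a₀, p ^ n) :: P) H ∈
      admissibleInvariants (pureHandle (k := k) ((a₀, p ^ n) :: (D.map (fun d => (d.1, p ^ n * d.2)) ++ P)) H) := by
  classical
  -- distinctness consequences
  have ha₀ : a₀ ∉ (D.map Prod.fst ++ P.map Prod.fst) ++ H.map Prod.fst ++ H.map (fun h => h.2.2) := by
    have h := hnodup
    rw [List.cons_append, List.cons_append, List.nodup_cons] at h
    exact h.1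
  have hDa : ∀ d ∈ D, d.1 ≠ a₀ := by
    intro d hd heq
    exact ha₀ (by rw [← heq]; simp [List.mem_map.2 ⟨d, hd, rfl⟩])
  have hPa : ∀ q ∈ P, q.1 ≠ a₀ := by
    intro q hq heq
    exact ha₀ (by rw [← heq]; simp [List.mem_map.2 ⟨q, hq, rfl⟩])
  have hHa : ∀ h ∈ H, h.1 ≠ a₀ ∧ h.2.2 ≠ a₀ := by
    intro h hh
    constructor
    · intro heq; exact ha₀ (by rw [← heq]; simp [List.mem_map.2 ⟨h, hh, rfl⟩])
    · intro heq; exact ha₀ (by rw [← heq]; simp [List.mem_map.2 ⟨h, hh, rfl⟩])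
  rw [admissibleInvariants_pureHandle_absorb p n a₀ D P H hDa hDpos hPa hHa]
  refine familyExps_mem ((a₀, p ^ n) :: P) H (fun q hq => ?_) ?_
  · rcases List.mem_cons.1 hq with rfl | hq
    · exact pow_pos hp.out.pos n
    · exact hP q hq
  · -- the cleaned variable list is a sublist of the full one
    have hsub : (((a₀, p ^ n) :: P).map Prod.fst ++ H.map Prod.fst ++ H.map fun h => h.2.2).Sublist
        ((a₀ :: (D.map Prod.fst ++ P.map Prod.fst)) ++ H.map Prod.fst ++ H.map fun h => h.2.2) := by
      rw [List.map_cons]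
      exact (((List.sublist_append_right (D.map Prod.fst) (P.map Prod.fst)).cons_cons a₀).append_right
        _).append_right _
    exact hnodup.sublist hsub

end Absorb

/-! ## §4 Absorbed pure powers next to the typed normal forms

Transport of the cell's certified maxima (`isMaxInv_umbrella`, `isMaxInv_umbrellaPow`, `isMaxInv_umbrellaCube'`)
along `admissibleInvariants_pureHandle_absorb`: pure powers `X_d^{p^n t}` absorbed by a block `X_{a₀}^{p^n}` of the
normal form do not change `max W` — the exceptional branch "`char = 2 ∧ q` even `↦ (2, m+1, m+1)`" of the census
laws MQ / AMQ (engine 1, FE33 C136) in theorem form. -/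

section Corollaries

variable (p : ℕ) [hp : Fact p.Prime] [CharP k p]

/-- The umbrella as a member of the family (plumbing). [cite: AbramovichTemkinWlodarczyk2024, §5.1 (p. 1575)] -/
theorem pureHandle_umbrella (i j l : Fin N) (a m : ℕ) (D : List (Fin N × ℕ)) :
    pureHandle (k := k) ((i, a) :: D) [(j, m, l)] = umbrella k i j l a m + purePart D := by
  simp [pureHandle, umbrella]
  ring

/-- **`max W(X_i^p + X_j^m X_l + Σ_d X_d^{p t_d}) = (p, m+1, m+1)`** in characteristic `p` (`p ≤ m`, `p ∤ m+1`;
`i, j, l` distinct, `d ≠ i`, `t_d ≥ 1`; any number of variables): the even/`p`-divisible pure powers are absorbed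
by `X_i^p`. (derived here: `isMaxInv_umbrella` + absorption)
[cite: AbramovichTemkinWlodarczyk2024, Thm. 5.3.1 (2)–(3) (p. 1578)] -/
theorem isMaxInv_umbrella_add_purePart {i j l : Fin N} {m : ℕ} (hij : i ≠ j) (hil : i ≠ l) (hjl : j ≠ l)
    (hpm : p ≤ m) (hndvd : ¬ p ∣ m + 1) (D : List (Fin N × ℕ)) (hDi : ∀ d ∈ D, d.1 ≠ i)
    (hDpos : ∀ d ∈ D, 0 < d.2) :
    IsMaxInv (admissibleInvariants (umbrella k i j l p m + purePart (D.map fun d => (d.1, p * d.2))))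
      [(p : ℚ), ((m + 1 : ℕ) : ℚ), ((m + 1 : ℕ) : ℚ)] := by
  have h := admissibleInvariants_pureHandle_absorb (k := k) p 1 i D [] [(j, m, l)] hDi hDpos (by simp)
    (by simpa using ⟨hij.symm, hil.symm⟩)
  rw [List.append_nil, pow_one, pureHandle_umbrella, pureHandle_umbrella, purePart_nil, add_zero] at h
  rw [h]
  exact isMaxInv_umbrella hij hil hjl hp.out.two_le hpm hndvd

/-- **`max W(X_i² + X_j^m X_l + X_e³ + Σ_d X_d^{2 t_d}) = (2, 3, m+1, m+1)`** over fields of characteristic `2`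
(`m ≥ 3`; `i, j, l, e` distinct, `d ≠ i`, `t_d ≥ 1`): even pure powers are absorbed by `X_i²`. (derived here:
`isMaxInv_umbrellaCube'` + absorption) [cite: AbramovichTemkinWlodarczyk2024, Thm. 5.3.1 (2)–(3) (p. 1578)] -/
theorem isMaxInv_umbrellaCube_add_purePart_charTwo [CharP k 2] {i j l e : Fin N} {m : ℕ} (hij : i ≠ j)
    (hil : i ≠ l) (hie : i ≠ e) (hjl : j ≠ l) (hje : j ≠ e) (hle : l ≠ e) (hm : 3 ≤ m) (D : List (Fin N × ℕ))
    (hDi : ∀ d ∈ D, d.1 ≠ i) (hDpos : ∀ d ∈ D, 0 < d.2) :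
    IsMaxInv (admissibleInvariants (umbrellaCube k i j l e m + purePart (D.map fun d => (d.1, 2 * d.2))))
      [(2 : ℚ), 3, ((m + 1 : ℕ) : ℚ), ((m + 1 : ℕ) : ℚ)] := by
  haveI : Fact (Nat.Prime 2) := ⟨Nat.prime_two⟩
  have h := admissibleInvariants_pureHandle_absorb (k := k) 2 1 i D [(e, 3)] [(j, m, l)] hDi hDpos
    (by simpa using hie.symm) (by simpa using ⟨hij.symm, hil.symm⟩)
  have e1 : pureHandle (k := k) ((i, 2 ^ 1) :: (D.map (fun d => (d.1, 2 ^ 1 * d.2)) ++ [(e, 3)])) [(j, m, l)] =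
      umbrellaCube k i j l e m + purePart (D.map fun d => (d.1, 2 * d.2)) := by
    rw [pow_one, pureHandle_umbrella, purePart_append, umbrellaCube]
    simp [purePart]
    ring
  have e2 : pureHandle (k := k) [(i, 2 ^ 1), (e, 3)] [(j, m, l)] = umbrellaCube k i j l e m := by
    rw [pow_one, pureHandle_umbrella, umbrellaCube]
    simp [purePart]
  rw [e1, e2] at h
  rw [h]
  exact isMaxInv_umbrellaCube' hij hil hie hjl hje hle hm

/-- **`max W(X_i² + X_j^m X_l + X_e³ + Σ_d X_d^{3 t_d}) = (2, 3, m+1, m+1)`** over fields of characteristic `3`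
(`m ≥ 3`; `i, j, l, e` distinct, `d ≠ e`, `t_d ≥ 1`): here the CUBE `X_e³` absorbs the pure powers divisible by
`3` — absorption by a non-leading block. (derived here: `isMaxInv_umbrellaCube'` + absorption)
[cite: AbramovichTemkinWlodarczyk2024, Thm. 5.3.1 (2)–(3) (p. 1578)] -/
theorem isMaxInv_umbrellaCube_add_purePart_charThree [CharP k 3] {i j l e : Fin N} {m : ℕ} (hij : i ≠ j)
    (hil : i ≠ l) (hie : i ≠ e) (hjl : j ≠ l) (hje : j ≠ e) (hle : l ≠ e) (hm : 3 ≤ m) (D : List (Fin N × ℕ))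
    (hDe : ∀ d ∈ D, d.1 ≠ e) (hDpos : ∀ d ∈ D, 0 < d.2) :
    IsMaxInv (admissibleInvariants (umbrellaCube k i j l e m + purePart (D.map fun d => (d.1, 3 * d.2))))
      [(2 : ℚ), 3, ((m + 1 : ℕ) : ℚ), ((m + 1 : ℕ) : ℚ)] := by
  haveI : Fact (Nat.Prime 3) := ⟨Nat.prime_three⟩
  have h := admissibleInvariants_pureHandle_absorb (k := k) 3 1 e D [(i, 2)] [(j, m, l)] hDe hDpos
    (by simpa using hie) (by simpa using ⟨hje, hle⟩)
  have e1 : pureHandle (k := k) ((e, 3 ^ 1) :: (D.map (fun d => (d.1, 3 ^ 1 * d.2)) ++ [(i, 2)])) [(j, m, l)] =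
      umbrellaCube k i j l e m + purePart (D.map fun d => (d.1, 3 * d.2)) := by
    rw [pow_one, pureHandle_umbrella, purePart_append, umbrellaCube, umbrella, umbrella]
    simp [purePart]
    ring
  have e2 : pureHandle (k := k) [(e, 3 ^ 1), (i, 2)] [(j, m, l)] = umbrellaCube k i j l e m := by
    rw [pow_one, pureHandle_umbrella, umbrellaCube, umbrella, umbrella]
    simp [purePart]
    ring
  rw [e1, e2] at h
  rw [h]
  exact isMaxInv_umbrellaCube' hij hil hie hjl hje hle hm

/-- **`max W(X_i² + X_j² X_l + X_e^q + Σ_d X_d^{2 t_d}) = (2, 3, 3, q)`** over fields of characteristic `2` for ODD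
`q ≥ 5` (`i, j, l, e` distinct, `d ≠ i`, `t_d ≥ 1`). (derived here: `isMaxInv_umbrellaPow` + absorption)
[cite: AbramovichTemkinWlodarczyk2024, Thm. 5.3.1 (2)–(3) (p. 1578)] -/
theorem isMaxInv_umbrellaPow_add_purePart_charTwo [CharP k 2] {i j l e : Fin N} {q : ℕ} (hij : i ≠ j)
    (hil : i ≠ l) (hie : i ≠ e) (hjl : j ≠ l) (hje : j ≠ e) (hle : l ≠ e) (hq : 4 ≤ q) (hodd : Odd q)
    (D : List (Fin N × ℕ)) (hDi : ∀ d ∈ D, d.1 ≠ i) (hDpos : ∀ d ∈ D, 0 < d.2) :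
    IsMaxInv (admissibleInvariants (umbrellaPow k i j l e q + purePart (D.map fun d => (d.1, 2 * d.2))))
      [(2 : ℚ), 3, 3, (q : ℚ)] := by
  haveI : Fact (Nat.Prime 2) := ⟨Nat.prime_two⟩
  have hqk : (q : k) ≠ 0 := by
    obtain ⟨r, rfl⟩ := hodd
    have h2 : (2 : k) = 0 := by simpa using CharP.cast_eq_zero k 2
    push_cast
    rw [h2, zero_mul, zero_add]
    exact one_ne_zero
  have h := admissibleInvariants_pureHandle_absorb (k := k) 2 1 i D [(e, q)] [(j, 2, l)] hDi hDpos
    (by simpa using hie.symm) (by simpa using ⟨hij.symm, hil.symm⟩)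
  have e1 : pureHandle (k := k) ((i, 2 ^ 1) :: (D.map (fun d => (d.1, 2 ^ 1 * d.2)) ++ [(e, q)])) [(j, 2, l)] =
      umbrellaPow k i j l e q + purePart (D.map fun d => (d.1, 2 * d.2)) := by
    rw [pow_one, pureHandle_umbrella, purePart_append, umbrellaPow]
    simp [purePart]
    ring
  have e2 : pureHandle (k := k) [(i, 2 ^ 1), (e, q)] [(j, 2, l)] = umbrellaPow k i j l e q := by
    rw [pow_one, pureHandle_umbrella, umbrellaPow]
    simp [purePart]
  rw [e1, e2] at h
  rw [h]
  exact isMaxInv_umbrellaPow hij hil hie hjl hje hle hqk hq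

end Corollaries

/-! ## §5 Worked instance (census shape `2 | 4` chain with a cube and a handle, characteristic 2) -/

section Example

/-- `f = X₀² + X₁⁴ + X₂³ + X₃² X₄` over a field of characteristic `2` (five variables): the cleaned lists
are `(0,2) :: [(2,3)]` (the `4` is absorbed by the `2`) and `[(3,2,4)]`, predicted value `(2, 3, 3, 3)`;
the theorem puts it in `W(f)`. [cite: AbramovichTemkinWlodarczyk2024, Thm. 5.3.1 (2) (p. 1578)] -/
example [CharP k 2] :
    [(2 : ℚ), 3, 3, 3] ∈ admissibleInvariants
      (X 0 ^ 2 + X 1 ^ 4 + X 2 ^ 3 + X 3 ^ 2 * X 4 : MvPolynomial (Fin 5) k) := by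
  haveI : Fact (Nat.Prime 2) := ⟨Nat.prime_two⟩
  have h := familyExps_mem_of_absorb (k := k) 2 1 (0 : Fin 5) [((1 : Fin 5), 2)] [((2 : Fin 5), 3)]
    [((3 : Fin 5), 2, (4 : Fin 5))] (by simp) (by simp) (by decide)
  have hv : familyExps [((0 : Fin 5), 2 ^ 1), ((2 : Fin 5), 3)] [((3 : Fin 5), 2, (4 : Fin 5))] =
      [(2 : ℚ), 3, 3, 3] := by
    norm_num [familyExps, List.insertionSort, List.orderedInsert]
  have hf : pureHandle (k := k) (((0 : Fin 5), 2 ^ 1) ::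
      ([((1 : Fin 5), 2)].map (fun d => (d.1, 2 ^ 1 * d.2)) ++ [((2 : Fin 5), 3)])) [((3 : Fin 5), 2, (4 : Fin 5))] =
      X 0 ^ 2 + X 1 ^ 4 + X 2 ^ 3 + X 3 ^ 2 * X 4 := by
    simp [pureHandle, purePart, handlePart]
    ring
  rwa [hv, hf] at h

end Example

end Literature.AlgebraicGeometry.Resolution.WeightedBlowup

-- #harness_tags
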